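import Literature.Probability.Percolation.CollarWindowLandings
import Literature.Probability.Percolation.Z2HalfPlaneThreeArm
import HarnessLib

/-!
# The window bound as a function of the distance to the corner

Topic `Probability/Percolation`.  Support file (proofs, no named fact) for the named fact
`SchrammSmirnov2011_thm_1_7` (the landing count of the proof of Prop. 4.1, Ann. Probab. 39 (2011),
§4): the probability of the bad patterns `(Q1) ∪ (Q2)` at a window of width `m` whose clean radius
is `t - 2` (think: `t` = distance to the nearer corner of the wall face), in closed form:
`≤ A (m/t)^{1+α₃}` from the half-plane three-arm bound alone (`real_patternAt_le_of_dist`,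
via `real_patternOne_union_patternTwo_le` and `real_threeArm_le`), and
`≤ A (m/t)^{1+α₃} (5t/S)^{α₁}` when moreover the far sites are at distance `≥ S ≥ 10 t` from the
window (`real_patternAt_le_of_dist_far`, via the two-factor bound
`real_patternAt_le_two_factor`).  Summed dyadically over the windows of a face these give the
smallness of the bad event of the face.

## References

* O. Schramm, S. Smirnov, *On the scaling limits of planar percolation*, Ann. Probab. 39 (2011)
  1768–1814, arXiv:1101.5820, §4, proof of Prop. 4.1. [SchrammSmirnov2011]
* G. Lawler, O. Schramm, W. Werner, *One-arm exponent for critical 2D percolation*, EJP 7 (2002),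
  Appendix A (half-plane three-arm bound). [LawlerSchrammWernerEJP2002]
-/

noncomputable section

open MeasureTheory Set Metric
open Literature.Probability.LatticeModels

namespace Literature.Probability.Percolation

open Z2HalfPlane

namespace Seeded

namespace CollarDatum

/-- The integer bookkeeping of a window with clean radius `d + m + 1` at distance `t = d + m + 3`:
with `n = d / K`, `m ≤ n`, `K n ≤ d` and `t ≤ 4 K n`. [folklore] -/
theorem window_arith {K m d : ℕ} (hK : 1 ≤ K) (hm : 4 ≤ m) (ht : 8 * K * m ≤ d + m + 3) :
    m ≤ d / K ∧ K * (d / K) ≤ d ∧ d + m + 3 ≤ 4 * K * (d / K) := by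
  have hM1 : m ≤ K * m := Nat.le_mul_of_pos_left m (by omega)
  have hM2 : K ≤ K * m := Nat.le_mul_of_pos_right K (by omega)
  have ht' : 8 * (K * m) ≤ d + m + 3 := by simpa [mul_assoc] using ht
  have hKm : K * m ≤ d := by omega
  have hdiv : K * (d / K) ≤ d := Nat.mul_div_le _ _
  have h1 : d < K * (d / K) + K := by
    have := Nat.lt_div_mul_add (a := d) (by omega : 0 < K)
    linarith [Nat.mul_comm (d / K) K]
  refine ⟨(Nat.le_div_iff_mul_le (by omega)).2 (by rw [mul_comm]; exact hKm), hdiv, ?_⟩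
  rw [show 4 * K * (d / K) = 4 * (K * (d / K)) by ring]
  generalize K * (d / K) = P at *
  generalize K * m = M at *
  omega

/-- **The window bound from the three-arm bound alone**: `P((Q1) ∪ (Q2) at a window of width m with
clean radius t - 2) ≤ A (m/t)^{1+α₃}`. [cite: SchrammSmirnov2011, §4, proof of Prop. 4.1; LawlerSchrammWernerEJP2002, Appendix A] -/
theorem real_patternAt_le_of_dist : ∃ A α₃ : ℝ, ∃ K : ℕ, 0 < A ∧ 0 < α₃ ∧ 1 ≤ K ∧
    ∀ (𝒞 : CollarDatum) (ψ : LatticeSym) (j : ℤ) (m d : ℕ), 4 ≤ m → 8 * K * m ≤ d + m + 3 →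
      (𝒞.map ψ).CleanWindow j m (d + m + 1) →
      (bondPercolation (zdGraph 2) half).real (𝒞.patternOneAt ψ j m ∪ 𝒞.patternTwoAt ψ j m) ≤
        A * ((m : ℝ) / (d + m + 3 : ℕ)) ^ (1 + α₃) := by
  obtain ⟨C₃, α₃, hC₃, hα₃, K, hK, h3⟩ := Z2HalfPlane.real_threeArm_le
  refine ⟨16 * C₃ * (4 * K : ℝ) ^ (1 + α₃), α₃, K, by positivity, hα₃, hK, fun 𝒞 ψ j m d hm ht hW => ?_⟩
  obtain ⟨hmn, hKn, htn⟩ := window_arith hK hm ht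
  set t : ℕ := d + m + 3 with ht_def
  set n : ℕ := d / K with hn
  rw [patternOneAt, patternTwoAt, ← Set.preimage_union, ψ.real_preimage_relabel]
  refine (real_patternOne_union_patternTwo_le hW le_rfl).trans ?_
  have h3' := h3 j m n d (by omega) hmn hKn
  have hn0 : (0 : ℝ) < n := by
    have : 1 ≤ n := le_trans (by omega) hmn
    exact_mod_cast this
  have ht0 : (0 : ℝ) < t := by
    have : 1 ≤ t := by omega
    exact_mod_cast this
  -- `m/n ≤ 4K m/t`
  have hmono : (m : ℝ) / n ≤ 4 * K * ((m : ℝ) / t) := by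
    rw [div_le_iff₀ hn0, show 4 * (K : ℝ) * ((m : ℝ) / t) * n = (m : ℝ) * ((4 * K * n : ℕ) : ℝ) / t by push_cast; ring,
      le_div_iff₀ ht0]
    have : (t : ℝ) ≤ ((4 * K * n : ℕ) : ℝ) := by exact_mod_cast htn
    have hm0 : (0 : ℝ) ≤ m := by positivity
    nlinarith
  calc 16 * (bondPercolation (zdGraph 2) half).real (threeArm j m d)
      ≤ 16 * (C₃ * ((m : ℝ) / n) ^ (1 + α₃)) := by nlinarith
    _ ≤ 16 * (C₃ * ((4 * K * ((m : ℝ) / t))) ^ (1 + α₃)) := by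
        gcongr
    _ = 16 * C₃ * (4 * K : ℝ) ^ (1 + α₃) * ((m : ℝ) / t) ^ (1 + α₃) := by
        rw [Real.mul_rpow (by positivity) (by positivity)]; ring

/-- **The window bound with the one-arm factor**: when the far sites are at distance `≥ S ≥ 10 t`
from the window corner (in the frame), `P ≤ A (m/t)^{1+α₃} (5t/S)^{α₁}`.
[cite: SchrammSmirnov2011, §4, proof of Prop. 4.1 with Lemma 6.2; LawlerSchrammWernerEJP2002, Appendix A] -/
theorem real_patternAt_le_of_dist_far : ∃ A α₃ α₁ : ℝ, ∃ K m₀ : ℕ, 0 < A ∧ 0 < α₃ ∧ 0 < α₁ ∧ 1 ≤ K ∧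
    ∀ (𝒞 : CollarDatum) (ψ : LatticeSym) (j : ℤ) (m d : ℕ) (S : ℝ), m₀ ≤ m → 8 * K * m ≤ d + m + 3 →
      10 * ((d + m + 3 : ℕ) : ℝ) ≤ S →
      (𝒞.map ψ).CleanWindow j m (d + m + 1) →
      (∀ u ∈ 𝒞.Far, S ≤ dist (meshPoint 1 (ψ.σ u)) (meshPoint 1 ![j, 0])) →
      (bondPercolation (zdGraph 2) half).real (𝒞.patternOneAt ψ j m ∪ 𝒞.patternTwoAt ψ j m) ≤
        A * ((m : ℝ) / (d + m + 3 : ℕ)) ^ (1 + α₃) * (5 * ((d + m + 3 : ℕ) : ℝ) / S) ^ α₁ := by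
  obtain ⟨C₃, α₃, hC₃, hα₃, K, hK, h3⟩ := Z2HalfPlane.real_threeArm_le
  obtain ⟨α₁, c₀, hα₁, hc₀, h2⟩ := real_patternAt_le_two_factor
  refine ⟨16 * C₃ * (4 * K : ℝ) ^ (1 + α₃), α₃, α₁, K, max 4 ⌈c₀⌉₊, by positivity, hα₃, hα₁, hK,
    fun 𝒞 ψ j m d S hm ht htS hW hFar => ?_⟩
  have hm4 : 4 ≤ m := le_trans (le_max_left _ _) hm
  have hmc₀ : c₀ ≤ m := by
    have h1 : (⌈c₀⌉₊ : ℝ) ≤ m := by exact_mod_cast le_trans (le_max_right _ _) hm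
    exact (Nat.le_ceil c₀).trans h1
  obtain ⟨hmn, hKn, htn⟩ := window_arith hK hm4 ht
  set t : ℕ := d + m + 3 with ht_def
  set n : ℕ := d / K with hn
  have hdt : d + m + 3 = t := rfl
  have ht0 : (0 : ℝ) < t := by
    have : 1 ≤ t := by omega
    exact_mod_cast this
  have hn0 : (0 : ℝ) < n := by
    have : 1 ≤ n := le_trans (by omega) hmn
    exact_mod_cast this
  -- the two-factor bound at `r = 2(m + 2d + 3)`, `R = S`
  set r : ℝ := 2 * ((m : ℝ) + 2 * d + 3) with hr
  have hr5 : r + 2 ≤ 5 * t := by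
    have : (d : ℝ) + m + 3 = t := by exact_mod_cast hdt
    have hm0 : (4 : ℝ) ≤ m := by exact_mod_cast hm4
    rw [hr]; nlinarith
  have hrc₀ : c₀ ≤ r + 2 := by
    have : (0 : ℝ) ≤ d := by positivity
    rw [hr]; nlinarith
  have hrS : 2 * (r + 2) ≤ S := by linarith
  have key := h2 𝒞 ψ j m (d + m + 1) d r S hW le_rfl le_rfl hrc₀ hrS hFar
  refine key.trans ?_
  have h3' := h3 j m n d (by omega) hmn hKn
  have hmono : (m : ℝ) / n ≤ 4 * K * ((m : ℝ) / t) := by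
    rw [div_le_iff₀ hn0, show 4 * (K : ℝ) * ((m : ℝ) / t) * n = (m : ℝ) * ((4 * K * n : ℕ) : ℝ) / t by push_cast; ring,
      le_div_iff₀ ht0]
    have : (t : ℝ) ≤ ((4 * K * n : ℕ) : ℝ) := by exact_mod_cast htn
    have hm0 : (0 : ℝ) ≤ m := by positivity
    nlinarith
  have hS0 : 0 < S := by linarith
  have hann : ((r + 2) / S) ^ α₁ ≤ (5 * (t : ℝ) / S) ^ α₁ := by
    refine Real.rpow_le_rpow (by positivity) ?_ hα₁.le
    exact div_le_div_of_nonneg_right hr5 hS0.le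
  have hthree : (bondPercolation (zdGraph 2) half).real (threeArm j m d) ≤ C₃ * (4 * K : ℝ) ^ (1 + α₃) * ((m : ℝ) / t) ^ (1 + α₃) := by
    calc (bondPercolation (zdGraph 2) half).real (threeArm j m d) ≤ C₃ * ((m : ℝ) / n) ^ (1 + α₃) := h3'
      _ ≤ C₃ * ((4 * K * ((m : ℝ) / t))) ^ (1 + α₃) := by gcongr
      _ = C₃ * (4 * K : ℝ) ^ (1 + α₃) * ((m : ℝ) / t) ^ (1 + α₃) := by
          rw [Real.mul_rpow (by positivity) (by positivity)]; ring
  have hnn : (0 : ℝ) ≤ ((r + 2) / S) ^ α₁ := by positivity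
  calc 16 * (bondPercolation (zdGraph 2) half).real (threeArm j m d) * ((r + 2) / S) ^ α₁
      ≤ 16 * (C₃ * (4 * K : ℝ) ^ (1 + α₃) * ((m : ℝ) / t) ^ (1 + α₃)) * (5 * (t : ℝ) / S) ^ α₁ := by
        gcongr
    _ = 16 * C₃ * (4 * K : ℝ) ^ (1 + α₃) * ((m : ℝ) / t) ^ (1 + α₃) * (5 * (t : ℝ) / S) ^ α₁ := by ring

end CollarDatum

end Seeded

end Literature.Probability.Percolation

end
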